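import Literature.NumberTheory.GaloisRepresentations.GalLayerSystemIhomLayers
import HarnessLib

/-!
# `Extⁿ_{C_Γ}(ℤ, Hom(N, lim S)) = lim→_E Hⁿ(Gal(E/F), Hom(N_E, S.obj E))` over the layers acting trivially on the
# lattice `N` — the colimit theorem (d) for `Hom`-coefficients, elementwise (Milne ADT I, proof of Lemma 1.9:
# `Extʳ_G(M, C) = lim→ Hʳ(G/U, Hom(M, C^U))`; Serre, *Galois Cohomology* I §2.2 Prop. 8)

Topic `NumberTheory/GaloisRepresentations`; namespace `Literature.NumberTheory.GaloisRepresentations.GalLayerData`.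
One definition with body (`ihomInflLayer`, the inflation from a trivialising layer) and theorems; no named fact, no
instance, no `sorry`.  Sequel to `GalLayerSystemIhomLayers.lean` (door-c6 g15: `coeff`, `TrivialOn`, `ihomLayerCohomologyIso`,
`ihomInf`, `ihomLayerCohomologyIso_stepG`) and to door-c4's `DiscreteRepLayerColimitGroupCohomology` ((d) in
`groupCohomology` currency: `inflG`, `exists_inflG_eq`, `exists_stepG_eq_zero`, `inflG_stepG`); trivialising layers exist by
`IdeleClassBar.exists_trivialOn` (`IdeleClassBarLatticeVanishing`).  The analogue for `Hom(N, lim S)` of door-c5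
g16's `GalLayerSystemColimit` (`inflLayer`, `exists_inflLayer_eq`, `exists_inf_eq_zero`) for `lim S` itself.

THE POINT.  For a Galois layer system `S = D.toSystem` (door-c5 g16: `C̄`, `J̄`, `lim Eˣ`) and a discrete lattice
`N = (V, ρN)` (`V` of finite type over `ℤ`, open stabilisers), the layers `E` whose group `Gal(F̄/E)` acts trivially on `V`
are cofinal, and along them
`Extⁿ_{C_{Γ_F}}(ℤ, Hom(N, lim S)) = lim→ (Hⁿ(Gal(E/F), Hom(N_E, D.obj E)), ihomInf)`:
**`exists_ihomInflLayer_eq`** (every class is inflated from such a layer), **`ihomInflLayer_ihomInf`** (compatibility),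
**`exists_ihomInf_eq_zero`** / **`exists_ihomInf_eq_ihomInf`** (a layer class dying in the limit dies under some
`ihomInf`).  With door-c4's `extIhomAddEquivOfProjective` / `extIhomAddEquivOfDivisible` (`Extⁿ(N, X) ≃ Extⁿ(ℤ, Hom(N, X))`)
this is the first step of Milne I Lemma 4.13 (`Ext¹_{Γ_K}(M^D, J̄) = lim→ H¹(Gal(E/K), Hom(M^D, J_E)) = P¹(K, M)`) and of
Lemma 1.9 (done for `C̄` in `IdeleClassBarLatticeVanishing`).

Written for Route A of the Poitou–Tate programme of crux `AnticycControlAdditiveK` (cell bsd-schneider, item 19295), seat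
door-c6 gen 15.  HONEST FRAMING: Galois-module bookkeeping only; no arithmetic statement and no case of BSD is proved.

## References
* J. S. Milne, *Arithmetic Duality Theorems* (2nd ed. 2006), I §1, Lemma 1.9 (proof); §4, Lemma 4.13. [MilneADT2006]
* J.-P. Serre, *Galois Cohomology*, Springer (1997), I §2.2 Proposition 8. [SerreGaloisCohomology1997]
* D. Harari, *Galois Cohomology and Class Field Theory* (2020), §16.2 Prop. 16.16 (b), §16.3 Lemma 16.20. [Harari2020]
-/

noncomputable section

open CategoryTheory CategoryTheory.Abelian groupCohomology
open Field (absoluteGaloisGroup)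
open Literature.Algebra.Homology
open scoped Classical

namespace Literature.NumberTheory.GaloisRepresentations

open IdeleClassBar

namespace GalLayerData

variable {F : Type} [Field F] [NumberField F] (D : GalLayerData F)
variable {V : Type} [AddCommGroup V] (ρN : Representation ℤ (absoluteGaloisGroup F) V)
  (hρN : DiscreteRep.IsDiscrete (Rep.of ρN)) [Module.Finite ℤ V]

/-! ## §1 The inflation from a trivialising layer -/

/-- **The inflation `Hⁿ(Gal(E/F), Hom(N_E, D.obj E)) →+ Extⁿ_{C_Γ}(ℤ, Hom(N, lim S))`** from a layer whose group acts
trivially on `N` (door-c4's `inflG U_E` after `ihomLayerCohomologyIso⁻¹`). [cite: SerreGaloisCohomology1997, I §2.2 Proposition 8] -/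
def ihomInflLayer {E : GalLayer F} (hE : TrivialOn ρN E) (n : ℕ) :
    groupCohomology ((Rep.ihom (coeff ρN hE)).obj (D.obj E)) n →+
      Ext (DiscreteRep.triv (Γ := absoluteGaloisGroup F) ℤ)
        (DiscreteRep.ihomObj (latticeD ρN hρN) D.toSystem.toD) n :=
  (DiscreteRep.LayerColimit.inflG E.openNormalSubgroup
      (DiscreteRep.ihomObj (latticeD ρN hρN) D.toSystem.toD) n).comp
    (D.ihomLayerCohomologyIso ρN hρN hE n).toLinearEquiv.symm.toAddMonoidHom

/-- Formula. [cite: SerreGaloisCohomology1997, I §2.2 Proposition 8] -/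
theorem ihomInflLayer_apply {E : GalLayer F} (hE : TrivialOn ρN E) (n : ℕ)
    (c : groupCohomology ((Rep.ihom (coeff ρN hE)).obj (D.obj E)) n) :
    D.ihomInflLayer ρN hρN hE n c =
      DiscreteRep.LayerColimit.inflG E.openNormalSubgroup (DiscreteRep.ihomObj (latticeD ρN hρN) D.toSystem.toD) n
        ((D.ihomLayerCohomologyIso ρN hρN hE n).inv c) := rfl

/-- `ihomInflLayer (iso c') = inflG U_E c'` for a class `c'` of door-c4's layer.
[cite: SerreGaloisCohomology1997, I §2.2 Proposition 8] -/
theorem ihomInflLayer_ihomLayerCohomologyIso_hom {E : GalLayer F} (hE : TrivialOn ρN E) (n : ℕ)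
    (c' : groupCohomology (D.ihomLayerRep ρN hρN E) n) :
    D.ihomInflLayer ρN hρN hE n ((D.ihomLayerCohomologyIso ρN hρN hE n).hom c') =
      DiscreteRep.LayerColimit.inflG E.openNormalSubgroup
        (DiscreteRep.ihomObj (latticeD ρN hρN) D.toSystem.toD) n c' := by
  rw [ihomInflLayer_apply, Iso.hom_inv_id_apply]

/-- **`iso_M⁻¹ ∘ ihomInf = stepG ∘ iso_E⁻¹`** (inverse form of `stepG_comp_ihomLayerCohomologyIso`).
[cite: SerreGaloisCohomology1997, I §2.2 Proposition 8] -/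
theorem ihomLayerCohomologyIso_inv_ihomInf {E M : GalLayer F} (h : E ≤ M) (hE : TrivialOn ρN E)
    (hM : TrivialOn ρN M) (n : ℕ) (c : groupCohomology ((Rep.ihom (coeff ρN hE)).obj (D.obj E)) n) :
    (D.ihomLayerCohomologyIso ρN hρN hM n).inv (D.ihomInf ρN h hE hM n c) =
      DiscreteRep.LayerColimit.stepG E.openNormalSubgroup M.openNormalSubgroup (GalLayer.coe_openNormalSubgroup_le h)
        (DiscreteRep.ihomObj (latticeD ρN hρN) D.toSystem.toD) n ((D.ihomLayerCohomologyIso ρN hρN hE n).inv c) := by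
  have hsq := D.ihomLayerCohomologyIso_stepG ρN hρN h hE hM n ((D.ihomLayerCohomologyIso ρN hρN hE n).inv c)
  rw [Iso.inv_hom_id_apply] at hsq
  rw [← hsq, Iso.hom_inv_id_apply]

/-- **The inflations are compatible with the system: `ihomInflLayer M (ihomInf h c) = ihomInflLayer E c`** (door-c4's
`inflG_stepG`). [cite: SerreGaloisCohomology1997, I §2.2 Proposition 8] -/
theorem ihomInflLayer_ihomInf {E M : GalLayer F} (h : E ≤ M) (hE : TrivialOn ρN E) (hM : TrivialOn ρN M) (n : ℕ)
    (c : groupCohomology ((Rep.ihom (coeff ρN hE)).obj (D.obj E)) n) :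
    D.ihomInflLayer ρN hρN hM n (D.ihomInf ρN h hE hM n c) = D.ihomInflLayer ρN hρN hE n c := by
  rw [ihomInflLayer_apply, ihomLayerCohomologyIso_inv_ihomInf, DiscreteRep.LayerColimit.inflG_stepG,
    ihomInflLayer_apply]

/-! ## §2 (d) along the trivialising layers -/

/-- **Every class of `Extⁿ_{C_Γ}(ℤ, Hom(N, lim S))` is inflated from a layer `E ≥ E₀` acting trivially on `N`**, for
any given trivialising `E₀` (door-c4's `exists_inflG_eq`, then a step to a layer below both).
[cite: SerreGaloisCohomology1997, I §2.2 Proposition 8][cite: MilneADT2006, I Lemma 1.9 (proof)] -/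
theorem exists_ihomInflLayer_eq {E₀ : GalLayer F} (hE₀ : TrivialOn ρN E₀) (n : ℕ)
    (x : Ext (DiscreteRep.triv (Γ := absoluteGaloisGroup F) ℤ)
      (DiscreteRep.ihomObj (latticeD ρN hρN) D.toSystem.toD) n) :
    ∃ (E : GalLayer F) (h₀ : E₀ ≤ E) (c : groupCohomology ((Rep.ihom (coeff ρN (hE₀.mono h₀))).obj (D.obj E)) n),
      D.ihomInflLayer ρN hρN (hE₀.mono h₀) n c = x := by
  obtain ⟨U, c', rfl⟩ := DiscreteRep.LayerColimit.exists_inflG_eq n _ x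
  obtain ⟨E, hUE, h₀E⟩ := GalLayer.exists_ge_ge (GalLayer.ofOpenNormalSubgroup U) E₀
  have hVU : (E.openNormalSubgroup : Subgroup (absoluteGaloisGroup F)) ≤ U := by
    have h' := GalLayer.coe_openNormalSubgroup_le hUE
    rwa [GalLayer.openNormalSubgroup_ofOpenNormalSubgroup] at h'
  refine ⟨E, h₀E, (D.ihomLayerCohomologyIso ρN hρN (hE₀.mono h₀E) n).hom
    (DiscreteRep.LayerColimit.stepG U E.openNormalSubgroup hVU _ n c'), ?_⟩
  rw [ihomInflLayer_ihomLayerCohomologyIso_hom, DiscreteRep.LayerColimit.inflG_stepG]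

/-- **A layer class dying in the limit dies under some `ihomInf`.** [cite: SerreGaloisCohomology1997, I §2.2 Proposition 8] -/
theorem exists_ihomInf_eq_zero {E : GalLayer F} (hE : TrivialOn ρN E) (n : ℕ)
    (c : groupCohomology ((Rep.ihom (coeff ρN hE)).obj (D.obj E)) n) (hc : D.ihomInflLayer ρN hρN hE n c = 0) :
    ∃ (M : GalLayer F) (h : E ≤ M), D.ihomInf ρN h hE (hE.mono h) n c = 0 := by
  obtain ⟨V, hVU, hV⟩ := DiscreteRep.LayerColimit.exists_stepG_eq_zero n _ E.openNormalSubgroup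
    ((D.ihomLayerCohomologyIso ρN hρN hE n).inv c) hc
  obtain ⟨M, rfl⟩ : ∃ M : GalLayer F, M.openNormalSubgroup = V :=
    ⟨_, GalLayer.openNormalSubgroup_ofOpenNormalSubgroup V⟩
  have h : E ≤ M := GalLayer.openNormalSubgroup_le_iff.1 hVU
  refine ⟨M, h, (D.ihomLayerCohomologyIso ρN hρN (hE.mono h) n).toLinearEquiv.symm.injective ?_⟩
  change (D.ihomLayerCohomologyIso ρN hρN (hE.mono h) n).inv (D.ihomInf ρN h hE (hE.mono h) n c) =
    (D.ihomLayerCohomologyIso ρN hρN (hE.mono h) n).inv 0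
  rw [map_zero, ihomLayerCohomologyIso_inv_ihomInf]
  exact hV

/-- **Two layer classes with the same image in the limit agree after some `ihomInf`.**
[cite: SerreGaloisCohomology1997, I §2.2 Proposition 8] -/
theorem exists_ihomInf_eq_ihomInf {E : GalLayer F} (hE : TrivialOn ρN E) (n : ℕ)
    (c c' : groupCohomology ((Rep.ihom (coeff ρN hE)).obj (D.obj E)) n)
    (h : D.ihomInflLayer ρN hρN hE n c = D.ihomInflLayer ρN hρN hE n c') :
    ∃ (M : GalLayer F) (hM : E ≤ M), D.ihomInf ρN hM hE (hE.mono hM) n c = D.ihomInf ρN hM hE (hE.mono hM) n c' := by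
  obtain ⟨M, hM, h0⟩ := D.exists_ihomInf_eq_zero ρN hρN hE n (c - c') (by rw [map_sub, h, sub_self])
  exact ⟨M, hM, sub_eq_zero.1 (by rw [← map_sub, h0])⟩

/-- **VANISHING TRANSFER for `Hom`-coefficients**: if every class of every trivialising layer `Hⁿ(Gal(E/F), Hom(N_E, D.obj E))`,
`E ≥ E₀`, is killed by some `ihomInf`, then `Extⁿ_{C_Γ}(ℤ, Hom(N, lim S)) = 0` (used with the Tate–Nakayama engine in
`IdeleClassBarLatticeVanishing`). [cite: MilneADT2006, I Lemma 1.9 (proof)][cite: Harari2020, §16.3 Lemma 16.20] -/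
theorem ext_triv_ihom_eq_zero_of_forall_exists_ihomInf_eq_zero {E₀ : GalLayer F} (hE₀ : TrivialOn ρN E₀) (n : ℕ)
    (hkill : ∀ (E : GalLayer F) (h₀ : E₀ ≤ E) (c : groupCohomology ((Rep.ihom (coeff ρN (hE₀.mono h₀))).obj (D.obj E)) n),
      ∃ (M : GalLayer F) (h : E ≤ M), D.ihomInf ρN h (hE₀.mono h₀) ((hE₀.mono h₀).mono h) n c = 0)
    (x : Ext (DiscreteRep.triv (Γ := absoluteGaloisGroup F) ℤ)
      (DiscreteRep.ihomObj (latticeD ρN hρN) D.toSystem.toD) n) : x = 0 := by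
  obtain ⟨E, h₀, c, rfl⟩ := D.exists_ihomInflLayer_eq ρN hρN hE₀ n x
  obtain ⟨M, h, hM⟩ := hkill E h₀ c
  rw [← D.ihomInflLayer_ihomInf ρN hρN h (hE₀.mono h₀) ((hE₀.mono h₀).mono h) n c, hM, map_zero]

end GalLayerData

end Literature.NumberTheory.GaloisRepresentations

end
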